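import Mathlib
import Summits.NavierStokesRegularity.FluidComputer.TransportGalerkinEnergyLevel
import HarnessLib

/-!
# Galerkin limit of the transport model, IX-a: tools for RESIDENCE — absorption, Gronwall window, two Cauchy–Schwarz inequalities, coordinates (instab g19, cell `ns-blowup`, 2026-08-27)

HONEST FRAMING (human ruling D-0035): nothing here is a claim about Navier–Stokes blow-up.
WHAT THIS IS NOT: not NS evidence — Gronwall bookkeeping on the scaled phase space
`E = lp (ℤ^d → V) 2` of the R-β chain; the Galerkin trajectory and its `H²` bound are hypotheses,
no flow or certificate is constructed.

PURPOSE. `HOME/instab/BETA2-SPEC.md` §6 priced RESIDENCE (β3) — «the Galerkin levels from the seed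
stay in the polynomial box `W` on the window» — as computer-assisted `C¹`-integration (engine class
M–L, not owned). THIS FILE PROVES IT IS CLASSICAL FOR `ν > 0`: a level-`N` Galerkin trajectory
`y` of `y' = P_N F(y)` (`F = nsField ν Uv π P`) which is `P_N`-fixed, satisfies the linear box
clauses, and obeys the `E`-norm (`= H²`) bound `‖y t‖ ≤ r` on `[0, T]` — the bound the KEEP/KILL
bootstrap ITSELF provides (`≤ (3/2)εe^{λt}`, resp. `≤ 2ε`) — has

* (§3, `energy_three_le`) `‖Λ⁻² ⇑(y t)‖₃² ≤ gronwallBound S₃(0) α₃ β₃ t` with LEVEL-INDEPENDENT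
  `α₃ = 2ν(2π)² + 2H(3)`, `β₃ = 27 c⁴ r⁶ / (256 (2ν(2π)²)³)`, `c = 2K₃σ₂` — the self-advection
  `2K₃ A₁(û) S₃ ≤ 2K₃σ₂ S₃^{3/2}` (Cauchy–Schwarz `A₁ ≤ σ₂‖û‖₃`, `σ₂² = ∑⟨l⟩⁻⁴`) is ABSORBED by the
  exact dissipation through `S₃² ≤ S₂ S₄ ≤ r² S₄` and `cY³ ≤ εY⁴ + 27c⁴/(256ε³)` (§1);
* (§4, `energy_le_of_energy_three_le`) for every `σ ≥ 1`, `S_σ(t) ≤ S_σ(0) e^{α t}` with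
  `α = 2ν(2π)² + 2H(σ) + 2K_σ σ₂ √R₃` once `S₃ ≤ R₃` on the window (linear Gronwall);
* (§5, `norm_apply_le_of_energy`) hence coordinate bounds `‖(y t) k‖ ≤ √R ⟨k⟩^{−s}` from
  `‖⇑(y t)‖_s² ≤ R` — i.e. membership in ONE polynomial box for all levels sharing `r` and the
  initial energies (the seed `ε P_N v` has `S_σ(0) ≤ ε² ‖v‖²_{σ}` for every `N`).

So between the certificates and the KEEP/KILL words for the model NO computer-assisted integration
stands: residence = (global existence of the finite-dimensional Galerkin ODE) + (the bootstrap's own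
`H²` bound) + THIS FILE. The size of the box never enters the KEEP floor (only the (C1)/(C2)
constants, of any sign), so the Gronwall constants may be astronomically large.

References: classical `H^m` energy method / parabolic regularisation for Navier–Stokes (Majda–Bertozzi
2002 §3.2; Constantin–Foias 1988 Ch. 10; Robinson–Rodrigo–Sadowski 2016 Ch. 6–7) [folklore shape].
-/

noncomputable section

open scoped ENNReal NNReal ComplexConjugate InnerProductSpace
open Set Filter Topology

namespace Summit.NavierStokesRegularity.FluidComputer.TransportGalerkinResidencePrep

open RCLike
open Literature.Analysis.FunctionSpaces Literature.Analysis.FunctionSpaces.Lattice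
open Literature.Analysis.FunctionSpaces.Torus
open Literature.Analysis.ODE
open Summit.NavierStokesRegularity.FluidComputer.GalerkinLatticePhaseSpace
open Summit.NavierStokesRegularity.FluidComputer.TransportGalerkin
open Summit.NavierStokesRegularity.FluidComputer.TransportGalerkinRapid
open Summit.NavierStokesRegularity.FluidComputer.TransportGalerkinBox
open Summit.NavierStokesRegularity.FluidComputer.TransportGalerkinWeights
open Summit.NavierStokesRegularity.FluidComputer.TransportGalerkinEnergyLevel

variable {d : Type*} [Fintype d] [DecidableEq d]
variable {V : Type*} [NormedAddCommGroup V] [InnerProductSpace ℂ V] [CompleteSpace V]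

/-! ## §1 Scalar lemmas: the absorption inequality and Gronwall bookkeeping -/

section Scalar

/-- **The absorption inequality** `c Y³ ≤ ε Y⁴ + 27 c⁴ / (256 ε³)` (`ε > 0`; all real `c, Y`): the
two sides touch at `Y = 3c/(4ε)`, and
`εY⁴ − cY³ + 27c⁴/(256ε³) = ε (Y − 3c/(4ε))² ((Y + c/(4ε))² + c²/(8ε²))`. -/
theorem young_three_four {ε : ℝ} (hε : 0 < ε) (c Y : ℝ) :
    c * Y ^ 3 ≤ ε * Y ^ 4 + 27 * c ^ 4 / (256 * ε ^ 3) := by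
  have key : ε * Y ^ 4 - c * Y ^ 3 + 27 * c ^ 4 / (256 * ε ^ 3) =
      ε * (Y - 3 * c / (4 * ε)) ^ 2 * ((Y + c / (4 * ε)) ^ 2 + c ^ 2 / (8 * ε ^ 2)) := by
    field_simp
    ring
  have hnn : 0 ≤ ε * (Y - 3 * c / (4 * ε)) ^ 2 * ((Y + c / (4 * ε)) ^ 2 + c ^ 2 / (8 * ε ^ 2)) := by
    positivity
  linarith

/-- **Gronwall's bound is dominated on a window**: for `δ, ε, K ≥ 0` and `0 ≤ x ≤ T`,
`gronwallBound δ K ε x ≤ (δ + ε T) e^{K T}`. -/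
theorem gronwallBound_le_window {δ K ε x T : ℝ} (hδ : 0 ≤ δ) (hK : 0 ≤ K) (hε : 0 ≤ ε)
    (hx : 0 ≤ x) (hxT : x ≤ T) :
    gronwallBound δ K ε x ≤ (δ + ε * T) * Real.exp (K * T) := by
  have hT : 0 ≤ T := hx.trans hxT
  have hexp1 : 1 ≤ Real.exp (K * T) := Real.one_le_exp (mul_nonneg hK hT)
  have hexpx : Real.exp (K * x) ≤ Real.exp (K * T) :=
    Real.exp_le_exp.2 (mul_le_mul_of_nonneg_left hxT hK)
  rcases eq_or_lt_of_le hK with hK0 | hKpos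
  · rw [← hK0, gronwallBound_K0]
    simp only [zero_mul, Real.exp_zero, mul_one]
    nlinarith
  · rw [gronwallBound_of_K_ne_0 hKpos.ne']
    simp only
    have h1 : ε / K * (Real.exp (K * x) - 1) ≤ ε * x * Real.exp (K * x) := by
      -- `e^t − 1 ≤ t e^t` (the tree's `AreaLaw.exp_sub_one_le_mul_exp`, re-derived inline to keep
      -- the fluid chain free of the lattice-gauge imports)
      have h : Real.exp (K * x) - 1 ≤ K * x * Real.exp (K * x) := by
        have h1 : (1 - K * x) * Real.exp (K * x) ≤ 1 := by
          calc (1 - K * x) * Real.exp (K * x) ≤ Real.exp (-(K * x)) * Real.exp (K * x) := by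
                gcongr; linarith [Real.add_one_le_exp (-(K * x))]
            _ = 1 := by rw [← Real.exp_add, neg_add_cancel, Real.exp_zero]
        nlinarith [h1, Real.exp_pos (K * x)]
      calc ε / K * (Real.exp (K * x) - 1) ≤ ε / K * (K * x * Real.exp (K * x)) :=
            mul_le_mul_of_nonneg_left h (by positivity)
        _ = ε * x * Real.exp (K * x) := by field_simp
    calc δ * Real.exp (K * x) + ε / K * (Real.exp (K * x) - 1)
        ≤ δ * Real.exp (K * T) + ε * T * Real.exp (K * T) := by
          refine add_le_add (mul_le_mul_of_nonneg_left hexpx hδ) (h1.trans ?_)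
          exact mul_le_mul (mul_le_mul_of_nonneg_left hxT hε) hexpx (Real.exp_pos _).le
            (mul_nonneg hε hT)
      _ = (δ + ε * T) * Real.exp (K * T) := by ring

/-- **Scalar Gronwall from a one-sided right-derivative bound** (Mathlib's
`le_gronwallBound_of_liminf_deriv_right_le` fed with `HasDerivWithinAt` on `Ici`). -/
theorem le_gronwallBound_of_hasDerivWithinAt {f f' : ℝ → ℝ} {K ε a b : ℝ}
    (hf : ContinuousOn f (Icc a b)) (hf' : ∀ x ∈ Ico a b, HasDerivWithinAt f (f' x) (Ici x) x)
    (bound : ∀ x ∈ Ico a b, f' x ≤ K * f x + ε) :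
    ∀ x ∈ Icc a b, f x ≤ gronwallBound (f a) K ε (x - a) :=
  le_gronwallBound_of_liminf_deriv_right_le hf
    (fun x hx _r hr => (hf' x hx).liminf_right_slope_le hr) le_rfl bound

end Scalar

/-! ## §2 Two Cauchy–Schwarz inequalities on the lattice -/

section CauchySchwarz

omit [DecidableEq d] [InnerProductSpace ℂ V] [CompleteSpace V] in
/-- **`A₁(u)² ≤ σ₂² ‖u‖₃²`**: `(∑_l ⟨l⟩‖u l‖)² ≤ (∑_l ⟨l⟩⁻⁴) · ∑_l ⟨l⟩⁶‖u l‖²` (Cauchy–Schwarz with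
the weights `⟨l⟩⁻⁴`, tree `Lattice.sq_tsum_mul_le`). In `d ≤ 3` the constant is the tree's
`σ₂² = ConvectiveProductLawBooking.tsum_sobolevWeight_neg_two_sq_lt_top`. -/
theorem sq_weightOne_tsum_le (u : (d → ℤ) → V) :
    (∑' l, ENNReal.ofReal (sobolevWeight 1 l) * ‖u l‖ₑ) ^ 2 ≤
      (∑' l : d → ℤ, ENNReal.ofReal (sobolevWeight (-2) l ^ 2)) * eNormSq 3 u := by
  have h := sq_tsum_mul_le (fun l : d → ℤ => ENNReal.ofReal (sobolevWeight (-2) l ^ 2))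
    (fun l => ENNReal.ofReal (sobolevWeight 5 l) * ‖u l‖ₑ)
  have h1 : ∀ l : d → ℤ, ENNReal.ofReal (sobolevWeight (-2) l ^ 2) *
      (ENNReal.ofReal (sobolevWeight 5 l) * ‖u l‖ₑ) = ENNReal.ofReal (sobolevWeight 1 l) * ‖u l‖ₑ := by
    intro l
    rw [← mul_assoc, ← ENNReal.ofReal_mul (sq_nonneg _)]
    congr 2
    rw [sq, ← sobolevWeight_add, ← sobolevWeight_add]; norm_num
  have h2 : ∀ l : d → ℤ, ENNReal.ofReal (sobolevWeight (-2) l ^ 2) *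
      (ENNReal.ofReal (sobolevWeight 5 l) * ‖u l‖ₑ) ^ 2 =
        ENNReal.ofReal (sobolevWeight 3 l ^ 2) * ‖u l‖ₑ ^ 2 := by
    intro l
    rw [mul_pow, ← mul_assoc, ← ENNReal.ofReal_pow (sobolevWeight_pos _ _).le,
      ← ENNReal.ofReal_mul (sq_nonneg _)]
    congr 2
    rw [← mul_pow, ← sobolevWeight_add]; norm_num
  simp only [h1, h2] at h
  exact h

omit [DecidableEq d] [InnerProductSpace ℂ V] [CompleteSpace V] in
/-- **Interpolation `‖u‖₃⁴ ≤ ‖u‖₂² ‖u‖₄²`** (`H³` is the midpoint of `H²` and `H⁴`; Cauchy–Schwarz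
with the weights `⟨l⟩⁴‖u l‖²`). -/
theorem eNormSq_three_sq_le (u : (d → ℤ) → V) :
    eNormSq 3 u ^ 2 ≤ eNormSq 2 u * eNormSq 4 u := by
  have h := sq_tsum_mul_le (fun l : d → ℤ => ENNReal.ofReal (sobolevWeight 2 l ^ 2) * ‖u l‖ₑ ^ 2)
    (fun l => ENNReal.ofReal (sobolevWeight 1 l ^ 2))
  have h1 : ∀ l : d → ℤ, ENNReal.ofReal (sobolevWeight 2 l ^ 2) * ‖u l‖ₑ ^ 2 *
      ENNReal.ofReal (sobolevWeight 1 l ^ 2) = ENNReal.ofReal (sobolevWeight 3 l ^ 2) * ‖u l‖ₑ ^ 2 := by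
    intro l
    rw [mul_right_comm, ← ENNReal.ofReal_mul (sq_nonneg _)]
    congr 2
    rw [← mul_pow, ← sobolevWeight_add]; norm_num
  have h2 : ∀ l : d → ℤ, ENNReal.ofReal (sobolevWeight 2 l ^ 2) * ‖u l‖ₑ ^ 2 *
      ENNReal.ofReal (sobolevWeight 1 l ^ 2) ^ 2 = ENNReal.ofReal (sobolevWeight 4 l ^ 2) * ‖u l‖ₑ ^ 2 := by
    intro l
    rw [mul_right_comm, ← ENNReal.ofReal_pow (sq_nonneg _), ← ENNReal.ofReal_mul (sq_nonneg _)]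
    congr 2
    rw [← pow_mul, show 2 * 2 = 4 by norm_num, show sobolevWeight 1 l ^ 4 = (sobolevWeight 1 l ^ 2) ^ 2 by ring,
      ← mul_pow, sq (sobolevWeight 1 l), ← sobolevWeight_add, ← sobolevWeight_add]
    norm_num
  simp only [h1, h2] at h
  exact h

omit [DecidableEq d] [InnerProductSpace ℂ V] [CompleteSpace V] in
/-- Real form of the two inequalities combined: with `S_s = ‖u‖_s²` finite and `σ₂² = ∑⟨l⟩⁻⁴` finite,
`A₁(u) · S₃ ≤ σ₂ · S₃^{1/2} · S₃` and `S₃² ≤ S₂ S₄`, packaged as the one inequality the absorption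
uses: `(A₁(u) S₃)⁴ ≤ σ₂⁴ S₂³ S₄³`… we only need the two square forms below. -/
theorem weightOne_tsum_sq_le_toReal {u : (d → ℤ) → V} (hu : eNormSq 3 u < ∞)
    (hσ₂ : ∑' l : d → ℤ, ENNReal.ofReal (sobolevWeight (-2) l ^ 2) < ∞) :
    (∑' l, ENNReal.ofReal (sobolevWeight 1 l) * ‖u l‖ₑ).toReal ^ 2 ≤
      (∑' l : d → ℤ, ENNReal.ofReal (sobolevWeight (-2) l ^ 2)).toReal * (eNormSq 3 u).toReal := by
  have h := sq_weightOne_tsum_le u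
  have hfin : (∑' l : d → ℤ, ENNReal.ofReal (sobolevWeight (-2) l ^ 2)) * eNormSq 3 u ≠ ∞ :=
    ENNReal.mul_ne_top hσ₂.ne hu.ne
  have := ENNReal.toReal_mono hfin h
  rwa [ENNReal.toReal_pow, ENNReal.toReal_mul] at this

omit [DecidableEq d] [InnerProductSpace ℂ V] [CompleteSpace V] in
/-- Real form: `S₃² ≤ S₂ S₄` for finite `S₂, S₄`. -/
theorem eNormSq_three_sq_le_toReal {u : (d → ℤ) → V} (h2 : eNormSq 2 u < ∞) (h4 : eNormSq 4 u < ∞) :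
    (eNormSq 3 u).toReal ^ 2 ≤ (eNormSq 2 u).toReal * (eNormSq 4 u).toReal := by
  have h := eNormSq_three_sq_le u
  have := ENNReal.toReal_mono (ENNReal.mul_ne_top h2.ne h4.ne) h
  rwa [ENNReal.toReal_pow, ENNReal.toReal_mul] at this

end CauchySchwarz

/-! ## §2b Unscaling bookkeeping -/

section Unscale

omit [DecidableEq d] [InnerProductSpace ℂ V] [CompleteSpace V] in
/-- Unscaling shifts the order by two: `‖Λ⁻² c‖_σ² = ‖c‖²_{σ−2}`. -/
theorem eNormSq_unscale [NormedSpace ℂ V] (σ : ℝ) (c : (d → ℤ) → V) :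
    eNormSq σ (wmul (-2) c) = eNormSq (σ - 2) c := by
  rw [eNormSq_wmul, sub_eq_add_neg]

omit [DecidableEq d] [CompleteSpace V] in
/-- The `E`-norm is the `H²` energy of the unscaled family: `‖x‖² = ‖Λ⁻² ⇑x‖₂²`. -/
theorem norm_sq_eq_energy_two (x : lp (fun _ : (d → ℤ) => V) 2) :
    ‖x‖ ^ 2 = (eNormSq 2 (wmul (-2) (⇑x))).toReal := by
  rw [norm_sq_eq_toReal_eNormSq_zero, eNormSq_unscale]; norm_num

end Unscale

/-! ## §5 From an energy bound to coordinate bounds (the box) -/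

section Coordinates

omit [DecidableEq d] [InnerProductSpace ℂ V] [CompleteSpace V] in
/-- **Energy bound ⇒ coordinate bound**: if `‖c‖_s² ≤ R` then `‖c k‖ ≤ √R ⟨k⟩^{−s}` for every mode
(`Lattice.term_le_eNormSq`). With `c = ⇑(y t)` and `s = 5` (unscaled order `7`,
`eNormSq_unscale`) this is membership of the Galerkin level in the polynomial box
`ρ k = √R ⟨k⟩^{−5}`, whose radii satisfy the summability hypotheses of the R-β chain in `d ≤ 3`. -/
theorem norm_apply_le_of_eNormSq_le {s R : ℝ} {c : (d → ℤ) → V} (hc : eNormSq s c < ∞)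
    (hR : (eNormSq s c).toReal ≤ R) (k : d → ℤ) :
    ‖c k‖ ≤ Real.sqrt R * sobolevWeight (-s) k := by
  have hw := sobolevWeight_pos s k
  have h1 : sobolevWeight s k ^ 2 * ‖c k‖ ^ 2 ≤ R := by
    have h := term_le_eNormSq s c k
    have hfin : eNormSq s c ≠ ∞ := hc.ne
    have := ENNReal.toReal_mono hfin h
    rw [ENNReal.toReal_mul, ENNReal.toReal_ofReal (sq_nonneg _), ← ofReal_norm,
      ← ENNReal.ofReal_pow (norm_nonneg _), ENNReal.toReal_ofReal (sq_nonneg _)] at this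
    exact this.trans hR
  have h2 : sobolevWeight s k * ‖c k‖ ≤ Real.sqrt R := by
    rw [← mul_pow] at h1
    calc sobolevWeight s k * ‖c k‖ = Real.sqrt ((sobolevWeight s k * ‖c k‖) ^ 2) :=
          (Real.sqrt_sq (by positivity)).symm
      _ ≤ Real.sqrt R := Real.sqrt_le_sqrt h1
  rw [sobolevWeight_neg, ← div_eq_mul_inv, le_div_iff₀ hw, mul_comm]
  exact h2

end Coordinates



end Summit.NavierStokesRegularity.FluidComputer.TransportGalerkinResidencePrep

end
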